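import Summits.AnomalousDissipation.AnomalousDissipation.Theses.TwoAndHalfD
import Summits.AnomalousDissipation.AnomalousDissipation.Theorems.TwoAndHalfDTwohalfdNegQuietOfSubLog
import Summits.AnomalousDissipation.AnomalousDissipation.Theorems.TwoAndHalfDTwohalfdNegReductionOffZero
import Literature.Analysis.FluidPDE.TwoHalfNavierStokes
import Literature.Analysis.FluidPDE.LongTimeAverageNonneg
import Literature.Analysis.FluidPDE.AgeDecouplingGridWindow
import Literature.Analysis.FluidPDE.AgeDecouplingGridEstimate
import Literature.Analysis.FluidPDE.PassiveScalarReleaseBounded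

-- LANDING LOG (stub_ageDecouplingGrid, S3' of line log-kantorovich-enstrophy-transfer, crux stmt-AnomalousDissipation-0211)
-- p116069 ACCEPTED → Literature/Analysis/FluidPDE/AgeDecouplingGridTrace.lean
--   (Torus.IsWeakScalarTransportOn.{ae_abs_releaseFlux_le, continuousOn_releaseTrace, abs_releaseTrace_sub_le_of_ae_le,
--    setIntegral_pairing_eq_integral_releaseTrace})
-- p116301 ACCEPTED → Literature/Analysis/FluidPDE/AgeDecouplingGridPairing.lean
--   (Torus.{ae_forall_scalar_release_pairing (P1), ae_forall_release_release_pairing (P2), ae_forall_release_slice,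
--    IsWeakScalarTransportOn.toReal_eScalarDissipation_le_half, abs_le_two_mul_sqrt_of_pairing, ae_sub_mem_Ioo_imp})
-- p116467 ACCEPTED → Literature/Analysis/FluidPDE/AgeDecouplingGridStep.lean
--   (AgeDecoupling.{window_ineq_of_grid, floor_sub_div_eq, sum_filter_lt_eq_sum_range})
-- p117187 ACCEPTED → Literature/Analysis/FluidPDE/AgeDecouplingGridSlack.lean (AgeDecoupling.{integral_slack_le, setIntegral_patchedSlack_eq, …})
-- p118142 ACCEPTED → Literature/Analysis/FluidPDE/AgeDecouplingGridData.lean (Torus.IsWeakScalarTransportOn.releaseTrace_data, …)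
-- p118233 ACCEPTED → Literature/Analysis/FluidPDE/AgeDecouplingGridEstimate.lean (Torus.longTimeAvgSup_dissipationRate_le_grid)
-- p119133 ACCEPTED → Literature/Analysis/FluidPDE/AgeDecouplingGridWindow.lean (Torus.ae_window_ineq)
-- this file → Summits/AnomalousDissipation/AnomalousDissipation/Theorems/TwoAndHalfDTwohalfdNegAgeDecouplingGrid.lean
--   (ledger propose --kind proof --target <that> --file work/stubs/stub_ageDecouplingGrid.lean --supports stmt-AnomalousDissipation-0211)

/-!
# Stub `stub_ageDecouplingGrid` (S3') of the line `log-kantorovich-enstrophy-transfer` for the crux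
# `TwoAndHalfD.TwohalfdNeg` (stmt-AnomalousDissipation-0211): grid age decoupling

**A steadily sourced passive scalar with bounded variance cannot dissipate in the mean unless GRID
RELEASES of its own source profile dissipate inside finite windows.** Planar global Leray–Hopf
drifts `v_j` (one fixed smooth mean-zero steady force `g`, viscosities `ν_j > 0`, mean energy
`≤ E`), the FIXED smooth mean-zero source `h`, global weak sourced scalars `θ_j`
(`∂ₜθ + v_j·∇θ = ν_jΔθ + h`, `L²` data) with `sup_j ⟨‖θ_j‖²⟩ ≤ R`. HYPOTHESIS: for every window
`S > 0`, mesh `δ > 0` and family `ϑ j n` of weak releases of `h` at the grid times `δ(n+1)` into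
`v_j` (weak on `[0, S+1)`), the `limsup` of the discrete Cesàro means of the age-`S` dissipations
tends to `0` as `j → ∞`. CONCLUSION: `χ_j = ⟨ν_j‖∇θ_j‖²⟩ → 0`.

Proof (the grid form of the age-decoupling inequality (★★) `χ ≤ R/(2S) + √(2R·D̄(S))`, rebuilt in
`≤ 400`-line layers over the landed substrate):
* `Literature/Analysis/FluidPDE/AgeDecouplingGridEstimate.longTimeAvgSup_dissipationRate_le_grid` —
  for ONE sourced scalar over a drift with `∫₀ᵀ‖∇v‖₂ < ∞`, locally integrable energy with bounded
  running means `⟨‖v‖²⟩ ≤ E`, `⟨‖θ‖²⟩ ≤ R`, `0 < δ ≤ S/2` and a family of BOUNDED grid releases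
  (`PassiveScalarReleaseBounded.exists_release_bounded_family`: choice, no measurability in the
  release time), `χ ≤ (√(S D̄) + √(R/(2S) + δ(K_a + ν* K_b)/S + 2S D̄))²` for `ν ≤ ν*`, with `D̄`
  the discrete Cesàro `limsup` of the window-`S` dissipations of the releases and `K_a, K_b`
  explicit in `S, R, E, h` (layers: `AgeDecouplingGridTrace/Pairing/Step/Data/Window/Slack`:
  pairing inequalities (P1)/(P2) a.e. in the observation time for the countable family, Riemann
  sums of the absolutely continuous traces, completing the square, the window inequality (H2) with
  an `O(δ)` slack, and the real-variable core `AgeDecoupling.longTimeAvgSup_le_of_window`);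
* the drift inputs come from the Leray–Hopf structure (`QuietOfSubLog.lintegral_rpow_half_eGradNormSq_lt_top`,
  `ReductionOffZero.integrableOn_integral_norm_sq`, `Torus.IsGlobalLerayHopf.isBoundedUnder_timeMean_energy`,
  the energy ceiling `meanEnergy (v j) ≤ E`);
* endgame (`tendsto_zero_of_ceiling_and_grid`): `χ_j ≤ ∫h²/ν_j` (`SourcedScalarBudget`) disposes of
  large viscosities, the quiet hypothesis makes `D̄_j → 0`, then `δ → 0`, then `S → ∞`
  (`AgeDecoupling.limsup_le_of_eventually_le_sq`, `tendsto_zero_of_forall_limsup_le_div`).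
`Torus.IsDivFree g` is not used (the weak formulation only sees the solenoidal part of the force).
Supports stmt-AnomalousDissipation-0211.
-/

namespace Summit.AnomalousDissipation.AnomalousDissipation.Theorems.TwohalfdNeg.AgeDecouplingGrid

open MeasureTheory Filter Topology
open scoped ENNReal NNReal
open Literature.Analysis.FunctionSpaces Literature.Analysis.FluidPDE

set_option linter.dupNamespace false

/-- **Endgame of the grid age-decoupling argument** (real sequences). A nonnegative sequence `x`
with the viscous ceiling `x_j ≤ H/ν_j` and, for every viscosity cut-off `ν* > 0` and window
`S > 0`, a constant `K ≥ 0` such that for every mesh `0 < δ ≤ S/2` there are `D_j ≥ 0`, `D_j → 0`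
with `x_j ≤ (√(S D_j) + √(R/(2S) + δK/S + 2S D_j))²` whenever `ν_j ≤ ν*`, tends to `0`: cut off at
`ν* = H/ε + 1`, let `j → ∞`, `δ → 0` (`AgeDecoupling.limsup_le_of_eventually_le_sq`) and `S → ∞`
(`AgeDecoupling.tendsto_zero_of_forall_limsup_le_div`). [folklore] -/
theorem tendsto_zero_of_ceiling_and_grid {x ν : ℕ → ℝ} {Hc Rv : ℝ} (hx0 : ∀ j, 0 ≤ x j) (hν : ∀ j, 0 < ν j)
    (hHc : 0 ≤ Hc) (hceil : ∀ j, x j ≤ Hc / ν j) (hRv : 0 ≤ Rv)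
    (hgrid : ∀ νs : ℝ, 0 < νs → ∀ S : ℝ, 0 < S → ∃ K : ℝ, 0 ≤ K ∧ ∀ δ : ℝ, 0 < δ → 2 * δ ≤ S →
      ∃ D : ℕ → ℝ, (∀ j, 0 ≤ D j) ∧ Tendsto D atTop (𝓝 0) ∧
        ∀ j, ν j ≤ νs → x j ≤ (Real.sqrt (S * D j) + Real.sqrt (Rv / (2 * S) + δ * K / S + 2 * S * D j)) ^ 2) :
    Tendsto x atTop (𝓝 0) := by
  rw [Metric.tendsto_atTop]
  intro ε hε
  set νs : ℝ := Hc / ε + 1 with hνs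
  have hνs0 : 0 < νs := by positivity
  set y : ℕ → ℝ := fun j => if ν j ≤ νs then x j else 0 with hy
  have hy0 : ∀ j, 0 ≤ y j := fun j => by
    simp only [hy]; split_ifs
    · exact hx0 j
    · exact le_rfl
  -- the grid bound for `y`, all `j`
  have hyb : ∀ S : ℝ, 0 < S → ∃ K : ℝ, 0 ≤ K ∧ ∀ δ : ℝ, 0 < δ → 2 * δ ≤ S →
      ∃ D : ℕ → ℝ, (∀ j, 0 ≤ D j) ∧ Tendsto D atTop (𝓝 0) ∧
        ∀ j, y j ≤ (Real.sqrt (S * D j) + Real.sqrt (Rv / (2 * S) + δ * K / S + 2 * S * D j)) ^ 2 := by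
    intro S hS
    obtain ⟨K, hK0, hK⟩ := hgrid νs hνs0 S hS
    refine ⟨K, hK0, fun δ hδ hδS => ?_⟩
    obtain ⟨D, hD0, hDt, hDb⟩ := hK δ hδ hδS
    refine ⟨D, hD0, hDt, fun j => ?_⟩
    simp only [hy]; split_ifs with hj
    · exact hDb j hj
    · positivity
  -- `limsup y ≤ Rv/(2S)` for every `S > 0`
  have hlim : ∀ S : ℝ, 0 < S → limsup y atTop ≤ Rv / (2 * S) := by
    intro S hS
    obtain ⟨K, hK0, hK⟩ := hyb S hS
    refine le_of_forall_pos_le_add fun η hη => ?_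
    set δ : ℝ := min (S / 2) (η * S / (K + 1)) with hδdef
    have hδ0 : 0 < δ := lt_min (by positivity) (by positivity)
    have hδS : 2 * δ ≤ S := by have := min_le_left (S / 2) (η * S / (K + 1)); linarith
    have hδK : δ * K / S ≤ η := by
      have h1 : δ ≤ η * S / (K + 1) := min_le_right _ _
      rw [div_le_iff₀ hS]
      have h2 : η * S / (K + 1) * K ≤ η * S := by
        rw [div_mul_eq_mul_div, div_le_iff₀ (by positivity)]; nlinarith
      nlinarith [mul_le_mul_of_nonneg_right h1 hK0]
    obtain ⟨D, -, hDt, hDb⟩ := hK δ hδ0 hδS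
    have h := Literature.Analysis.FluidPDE.AgeDecoupling.limsup_le_of_eventually_le_sq (l := atTop) (x := y)
      (a := fun _ => Rv / (2 * S) + δ * K / S) (d := D) (A := Rv / (2 * S) + δ * K / S) (S := S) hS.le (by positivity)
      (Eventually.of_forall hy0) (fun ε' hε' => Eventually.of_forall fun j => by linarith)
      (fun ε' hε' => (hDt.eventually (ge_mem_nhds hε')).mono fun j hj => hj) (Eventually.of_forall hDb)
    linarith
  -- `y` is eventually bounded (window `S = 1`, mesh `δ = 1/2`)
  have hbdd : IsBoundedUnder (· ≤ ·) atTop y := by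
    obtain ⟨K, hK0, hK⟩ := hyb 1 one_pos
    obtain ⟨D, hD0, hDt, hDb⟩ := hK (1 / 2) (by norm_num) (by norm_num)
    refine ⟨(Real.sqrt (1 * 1) + Real.sqrt (Rv / (2 * 1) + 1 / 2 * K / 1 + 2 * 1 * 1)) ^ 2, ?_⟩
    rw [eventually_map]
    filter_upwards [hDt.eventually (ge_mem_nhds one_pos)] with j hj
    refine (hDb j).trans (pow_le_pow_left₀ (by positivity) (add_le_add ?_ ?_) 2)
    · exact Real.sqrt_le_sqrt (by nlinarith)
    · exact Real.sqrt_le_sqrt (by nlinarith)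
  have hyt : Tendsto y atTop (𝓝 0) :=
    Literature.Analysis.FluidPDE.AgeDecoupling.tendsto_zero_of_forall_limsup_le_div hy0 hbdd hlim
  -- back to `x`
  obtain ⟨N, hN⟩ := (Metric.tendsto_atTop.1 hyt) ε hε
  refine ⟨N, fun j hj => ?_⟩
  have h1 := hN j hj
  rw [Real.dist_eq, sub_zero] at h1 ⊢
  rw [abs_of_nonneg (hx0 j)]
  by_cases hjν : ν j ≤ νs
  · rw [abs_of_nonneg (hy0 j)] at h1
    simp only [hy, hjν, if_true] at h1
    exact h1
  · rw [not_le] at hjν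
    calc x j ≤ Hc / ν j := hceil j
      _ < ε := by
        rw [div_lt_iff₀ (hν j)]
        have e : ε * νs = Hc + ε := by simp only [hνs]; field_simp
        nlinarith

/-- **S3' `stub_ageDecouplingGrid` — grid age decoupling** (see the module docstring).
HYPOTHESES: smooth (divergence-free, mean-zero) steady `g`; smooth mean-zero `h`; `ν_j > 0`; global
Leray–Hopf `v_j` (force `g`) with `meanEnergy (v j) ≤ E`; `L²` data and global weak sourced scalars
`θ_j` driven by `v_j` with source `h` and `⟨‖θ_j‖²⟩ ≤ R`; finite-window quietness of every family of
GRID releases of `h` in discrete Cesàro mean. CONCLUSION: `⟨ν_j‖∇θ_j‖²⟩ → 0`. -/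
theorem stub_ageDecouplingGrid :
    ∀ (g : UnitAddTorus (Fin 2) → EuclideanSpace ℝ (Fin 2)) (h : UnitAddTorus (Fin 2) → ℝ),
      Torus.IsSmooth g → Torus.IsDivFree g → Torus.HasZeroMean g →
      Torus.IsSmooth h → Torus.HasZeroMean h →
      ∀ (ν : ℕ → ℝ) (v₀ : ℕ → UnitAddTorus (Fin 2) → EuclideanSpace ℝ (Fin 2))
        (v : ℕ → ℝ → UnitAddTorus (Fin 2) → EuclideanSpace ℝ (Fin 2))
        (θ₀ : ℕ → UnitAddTorus (Fin 2) → ℝ) (θ : ℕ → ℝ → UnitAddTorus (Fin 2) → ℝ),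
        (∀ j, 0 < ν j) →
        (∀ j, Torus.IsGlobalLerayHopf (ν j) (fun _ => g) (v₀ j) (v j)) →
        (∃ E : ℝ, ∀ j, meanEnergy (v j) ≤ E) →
        (∀ j, MemLp (θ₀ j) 2 volume) →
        (∀ j, Torus.IsWeakScalarTransportForced (ν j) (v j) (fun _ => h) (θ₀ j) (θ j)) →
        (∃ E : ℝ, ∀ j, longTimeAvgSup (fun t => Torus.scalarL2Sq (θ j t)) ≤ E) →
        (∀ S δ : ℝ, 0 < S → 0 < δ → ∀ ϑ : ℕ → ℕ → ℝ → UnitAddTorus (Fin 2) → ℝ,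
          (∀ (j n : ℕ), Torus.IsWeakScalarTransportOn (S + 1) (ν j)
              (fun τ => v j (δ * (n + 1) + τ)) h (ϑ j n)) →
          Tendsto (fun j => limsup (fun N : ℕ => (N : ℝ)⁻¹ *
              ∑ n ∈ Finset.range N, (Torus.eScalarDissipation (ν j) (ϑ j n) 0 S).toReal) atTop)
            atTop (𝓝 0)) →
        Tendsto (fun j => longTimeAvgSup
          (fun t => ν j * (Torus.eScalarGradNormSq (θ j t)).toReal)) atTop (𝓝 0) := by
  intro g h hgs _hgd hgz hhs hhz ν v₀ v θ₀ θ hν hLH hEv hθ₀ hθw hEθ hquiet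
  obtain ⟨E, hE⟩ := hEv
  obtain ⟨Rv, hRv⟩ := hEθ
  -- sup-norm bounds of the profile on the compact torus
  obtain ⟨H, hH⟩ : ∃ H : ℝ, ∀ x, |h x| ≤ H := by
    obtain ⟨H, hH⟩ := Torus.exists_forall_norm_le_of_continuous hhs.continuous
    exact ⟨H, fun x => (Real.norm_eq_abs (h x)) ▸ hH x⟩
  obtain ⟨Cg, hCg⟩ : ∃ Cg : ℝ, ∀ x, ‖Torus.gradient h x‖ ≤ Cg :=
    Torus.exists_forall_norm_le_of_continuous hhs.gradient.continuous
  obtain ⟨Cl, hCl⟩ : ∃ Cl : ℝ, ∀ x, |Torus.laplacian h x| ≤ Cl := by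
    obtain ⟨Cl, hCl⟩ := Torus.exists_forall_norm_le_of_continuous hhs.laplacian.continuous
    exact ⟨Cl, fun x => (Real.norm_eq_abs (Torus.laplacian h x)) ▸ hCl x⟩
  have hCg0 : 0 ≤ Cg := (norm_nonneg _).trans (hCg 0)
  have hCl0 : 0 ≤ Cl := (abs_nonneg _).trans (hCl 0)
  have hH20 : 0 ≤ ∫ y, h y ^ 2 := integral_nonneg fun _ => sq_nonneg _
  -- the Leray–Hopf drifts
  have hG : ∀ j T, 0 < T → ∫⁻ t in Set.Ioo 0 T, Torus.eGradNormSq (v j t) ^ (1 / 2 : ℝ) < ⊤ := fun j T hT =>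
    QuietOfSubLog.lintegral_rpow_half_eGradNormSq_lt_top (hLH j) hT
  have hEu : ∀ j T, 0 < T → IntegrableOn (fun s => ∫ y, ‖v j s y‖ ^ 2) (Set.Ioc 0 T) volume := fun j T hT =>
    ReductionOffZero.integrableOn_integral_norm_sq (hν j) (hgs.memLp 2) (hLH j) hT
  have hEb : ∀ j, IsBoundedUnder (· ≤ ·) atTop (timeMean fun s => ∫ y, ‖v j s y‖ ^ 2) := fun j =>
    Torus.IsGlobalLerayHopf.isBoundedUnder_timeMean_energy (hν j) (hgs.memLp 2) hgz (hLH j)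
  have hE' : ∀ j, longTimeAvgSup (fun s => ∫ y, ‖v j s y‖ ^ 2) ≤ E := fun j => by
    rw [← meanEnergy_eq_longTimeAvgSup]; exact hE j
  -- the viscous ceiling and nonnegativity
  have hx0 : ∀ j, 0 ≤ longTimeAvgSup (fun t => ν j * (Torus.eScalarGradNormSq (θ j t)).toReal) := fun j =>
    longTimeAvgSup_nonneg fun t => mul_nonneg (hν j).le ENNReal.toReal_nonneg
  have hceil : ∀ j, longTimeAvgSup (fun t => ν j * (Torus.eScalarGradNormSq (θ j t)).toReal) ≤ (∫ y, h y ^ 2) / ν j :=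
    fun j => Torus.longTimeAvgSup_dissipationRate_le (hν j) (hθw j) (hθ₀ j) hhs hhz (hG j)
  have hRv0 : 0 ≤ Rv := (longTimeAvgSup_nonneg fun t => integral_nonneg fun _ => sq_nonneg _).trans (hRv 0)
  have hE0 : 0 ≤ E := (meanEnergy_nonneg (v 0)).trans (hE 0)
  refine tendsto_zero_of_ceiling_and_grid hx0 hν hH20 hceil hRv0 fun νs hνs S hS => ?_
  refine ⟨(2 + (∫ y, h y ^ 2) * (Rv + 1) + S * (Cg / 2 * (Rv + 1) + Cg / 2 * (E + 1) + ∫ y, h y ^ 2) +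
      3 / 2 * S * (∫ y, h y ^ 2) + S ^ 2 * Cg * (∫ y, h y ^ 2) + S ^ 2 * Cg * (E + 1)) +
      νs * (S * (Cl / 2 * (Rv + 1) + Cl / 2) + S ^ 2 * Cl * (1 + ∫ y, h y ^ 2)), ?_, fun δ hδ hδS => ?_⟩
  · have := hS.le; have := hνs.le
    positivity
  -- the bounded grid releases (choice) and their quietness
  have hfam := fun j => (hLH j).exists_release_bounded_family (hν j) (by linarith : (0 : ℝ) < S + 1)
    (σ := fun n : ℕ => δ * (n + 1)) (fun n => by positivity) hhs hH
  choose ϑ hϑ using hfam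
  refine ⟨fun j => limsup (fun N : ℕ => (N : ℝ)⁻¹ * ∑ n ∈ Finset.range N, (Torus.eScalarDissipation (ν j) (ϑ j n) 0 S).toReal) atTop,
    fun j => limsup_nonneg_of_eventually_nonneg (Eventually.of_forall fun N => ?_),
    hquiet S δ hS hδ ϑ (fun j n => (hϑ j n).1), fun j hj => ?_⟩
  · exact mul_nonneg (inv_nonneg.2 (Nat.cast_nonneg _)) (Finset.sum_nonneg fun n _ => ENNReal.toReal_nonneg)
  · exact Torus.longTimeAvgSup_dissipationRate_le_grid (hν j) hj (hθw j) (hθ₀ j) hhs hhz hCg hCl (hG j) (hEu j) (hEb j)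
      (hRv j) (hE' j) hδ hδS (fun n => (hϑ j n).1)
      (Torus.ae_window_ineq (hν j) (hθw j) (hθ₀ j) hhs hCg hCl (hG j) (hEu j) hδ hδS (fun n => (hϑ j n).1)
        (fun n => (hϑ j n).2.2) (fun n => (hϑ j n).2.1))

end Summit.AnomalousDissipation.AnomalousDissipation.Theorems.TwohalfdNeg.AgeDecouplingGrid
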